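import Mathlib
import Summits.AtomisticToContinuum.Crystallization.Theorems.NashClassCertificatesNashNearFieldBondStiffnessSecondShell

/-!
# Crux `NashNearField` (stmt-AtomisticToContinuum-16827), line `birth`: far-shell bound on the pair force-constant form

Third and farther shells of the tube (`‖e‖ ≥ 3/2`) enter any tube-coercivity certificate only through a summable tail.  The mirror file's
crude bound `|Hess₀ e w| ≤ 904‖e‖⁻⁸` (`‖e‖ ≥ 1/2`, `‖w‖ = 1`) is sharpened on `‖e‖ ≥ 3/2` to
`|Hess₀ e w| ≤ 10·‖e‖⁻⁸·‖w‖²` (`abs_Hess₀_le_far`): with `x = ‖e‖⁻¹ ≤ 2/3`,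
`|V″| + |V′|/r ≤ 14x¹⁴ + 8x⁸ ≤ (14·(2/3)⁶ + 8)x⁸ ≤ 10x⁸`.  Summed over the shells of a `1/3`-separated configuration this is the `O(R⁻⁵)`
tail that the frozen-exterior Hessian certificate must absorb beyond its cut-off radius `R`.  `[folklore]`.
-/

noncomputable section

open Literature.MathematicalPhysics.StatisticalMechanics

namespace Summit.AtomisticToContinuum.Crystallization.Theorems.NashClassCertificatesNashNearField

open Summit.AtomisticToContinuum.Crystallization.Theorems.PhononStabilityNegative

/-- **Far-shell bound**: `|Hess₀ e w| ≤ 10·‖e‖⁻⁸·‖w‖²` for `‖e‖ ≥ 3/2`. [folklore] -/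
theorem abs_Hess₀_le_far {e : EuclideanSpace ℝ (Fin 3)} (w : EuclideanSpace ℝ (Fin 3)) (he : (3 / 2 : ℝ) ≤ ‖e‖) :
    |Hess₀ e w| ≤ 10 * (‖e‖⁻¹) ^ 8 * ‖w‖ ^ 2 := by
  have hpos : 0 < ‖e‖ := by linarith
  have hne : ‖e‖ ≠ 0 := hpos.ne'
  refine (abs_Hess₀_le e w).trans ?_
  rw [deriv_deriv_lennardJones hne, deriv_lennardJones hne]
  set x := ‖e‖⁻¹ with hx
  have hx0 : 0 < x := inv_pos.2 hpos
  have hx2 : x ≤ 2 / 3 := by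
    rw [hx]; exact inv_le_of_inv_le₀ (by norm_num) (by norm_num; exact he)
  have hdiv : |-(x ^ 13) + x ^ 7| / ‖e‖ = |-(x ^ 13) + x ^ 7| * x := by rw [hx, div_eq_mul_inv]
  rw [hdiv]
  have hA : |13 * x ^ 14 - 7 * x ^ 8| ≤ 13 * x ^ 14 + 7 * x ^ 8 := by
    refine abs_le.2 ⟨?_, ?_⟩ <;> nlinarith [pow_nonneg hx0.le 14, pow_nonneg hx0.le 8]
  have hB : |-(x ^ 13) + x ^ 7| ≤ x ^ 13 + x ^ 7 := by
    refine abs_le.2 ⟨?_, ?_⟩ <;> nlinarith [pow_nonneg hx0.le 13, pow_nonneg hx0.le 7]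
  have hx6 : x ^ 6 ≤ (2 / 3 : ℝ) ^ 6 := pow_le_pow_left₀ hx0.le hx2 6
  have h8 : 0 ≤ x ^ 8 := pow_nonneg hx0.le 8
  have hw : 0 ≤ ‖w‖ ^ 2 := sq_nonneg _
  have hbr : |13 * x ^ 14 - 7 * x ^ 8| + |-(x ^ 13) + x ^ 7| * x ≤ 10 * x ^ 8 := by
    calc |13 * x ^ 14 - 7 * x ^ 8| + |-(x ^ 13) + x ^ 7| * x
        ≤ (13 * x ^ 14 + 7 * x ^ 8) + (x ^ 13 + x ^ 7) * x := by gcongr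
      _ = 14 * (x ^ 8 * x ^ 6) + 8 * x ^ 8 := by ring
      _ ≤ 14 * (x ^ 8 * (2 / 3 : ℝ) ^ 6) + 8 * x ^ 8 := by gcongr
      _ ≤ 10 * x ^ 8 := by nlinarith
  calc (|13 * x ^ 14 - 7 * x ^ 8| + |-(x ^ 13) + x ^ 7| * x) * ‖w‖ ^ 2 ≤ 10 * x ^ 8 * ‖w‖ ^ 2 :=
        mul_le_mul_of_nonneg_right hbr hw
    _ = 10 * x ^ 8 * ‖w‖ ^ 2 := rfl

end Summit.AtomisticToContinuum.Crystallization.Theorems.NashClassCertificatesNashNearField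

end
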